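import Mathlib
import Summits.ValiantsHypothesis.ValiantsHypothesis.Theorems.FifoMatchingNNLinearDegreeCofactorHardPassagePricing
import HarnessLib

/-!
# Crux `NNLinearDegreeCofactorHard` (stmt-ValiantsHypothesis-23918), line `internal_cofactor`: passage pricing with ONE
# unmatched failed gate

`CondProbBits.card_mul_le_of_passages` needs every failed soft coin to own a test (`F ≤ T`).  The attribution of the
`shedWord` gates leaves the LAST failed gate of a word possibly unmatched (the block at the front at the adaptive time `E`), so
we record the variant with `F ≤ T + 1`, paid for by two passages: `#A · (4/3)^P ≤ 2^J` whenever `P + 2 ≤ T + G`.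

Honest framing: elementary counting over the landed supermartingale; nothing here proves S2b, the crux or VP ≠ VNP.
No definitions, no named facts.
-/

noncomputable section

-- Sub = Summit single-conjunct layout: the duplicated namespace component is mandated by the tree.
set_option linter.dupNamespace false

namespace Summit.ValiantsHypothesis.ValiantsHypothesis.Theorems.FifoMatching.NNLinearDegreeCofactorHard.CondProbBits

open Finset

variable {J : ℕ}

/-- **Gain with one unmatched failed gate**: `2^T (4/3)^G (2/3)^F ≥ (4/3)^P` whenever `F ≤ T + 1` and `P + 2 ≤ T + G`.
[folklore] -/
theorem gain_ge_succ (T G F P : ℕ) (hF : F ≤ T + 1) (hP : P + 2 ≤ T + G) :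
    (4 / 3 : ℝ) ^ P ≤ 2 ^ T * (4 / 3 : ℝ) ^ G * (2 / 3 : ℝ) ^ F := by
  rcases Nat.lt_or_ge F (T + 1) with h | h
  · exact gain_ge T G F P (by omega) (by omega)
  · have hFT : F = T + 1 := le_antisymm hF h
    subst hFT
    -- `2^T (2/3)^(T+1) = (2/3) (4/3)^T`
    have h1 : (2 : ℝ) ^ T * (2 / 3 : ℝ) ^ (T + 1) = (2 / 3 : ℝ) * (4 / 3 : ℝ) ^ T := by
      rw [pow_succ, ← mul_assoc, ← mul_pow]; norm_num; ring
    have hTG : P + 2 ≤ T + G := hP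
    calc (4 / 3 : ℝ) ^ P = (27 / 32 : ℝ) * ((2 / 3 : ℝ) * (4 / 3 : ℝ) ^ (P + 2)) := by
          rw [pow_add]; ring
      _ ≤ 1 * ((2 / 3 : ℝ) * (4 / 3 : ℝ) ^ (T + G)) :=
          mul_le_mul (by norm_num)
            (mul_le_mul_of_nonneg_left (pow_le_pow_right₀ (by norm_num) hTG) (by norm_num))
            (by positivity) (by norm_num)
      _ = 2 ^ T * (4 / 3 : ℝ) ^ G * (2 / 3 : ℝ) ^ (T + 1) := by
          rw [one_mul, pow_add, mul_assoc, mul_comm ((4 / 3 : ℝ) ^ G), ← mul_assoc, ← mul_assoc, ← h1]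

/-- **Passage pricing with one unmatched failed gate.**  Kinds `κ j v ∈ {1 forced, 2 soft, else free}` and designated values
`f j v` depend on the bits `< j` only; every word of `A` takes the designated value at its forced coins, its failed soft coins
number at most the forced coins PLUS ONE, and `P + 2 ≤ T + G`.  Then `#A · (4/3)^P ≤ 2^J`. [folklore] -/
theorem card_mul_le_of_passages_succ (κ : ℕ → (Fin J → Bool) → ℕ) (f : ℕ → (Fin J → Bool) → Bool)
    (hκ : ∀ j (v w : Fin J → Bool), (∀ i : Fin J, i.val < j → v i = w i) → κ j v = κ j w ∧ f j v = f j w)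
    (A : Finset (Fin J → Bool)) (P : ℕ)
    (hforced : ∀ v ∈ A, ∀ j < J, κ j v = 1 → bitAt v j = f j v)
    (hF : ∀ v ∈ A, ((range J).filter fun j => κ j v = 2 ∧ bitAt v j ≠ f j v).card
      ≤ ((range J).filter fun j => κ j v = 1).card + 1)
    (hP : ∀ v ∈ A, P + 2 ≤ ((range J).filter fun j => κ j v = 1).card
      + ((range J).filter fun j => κ j v = 2 ∧ bitAt v j = f j v).card) :
    (A.card : ℝ) * (4 / 3 : ℝ) ^ P ≤ 2 ^ J := by
  have h2J : (0 : ℝ) < 2 ^ J := by positivity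
  have key := card_mul_le_one_of_condWeightBit (passageWeight κ f) (passageWeight_nonneg κ f)
    (fun j v w h => passageWeight_eq_of_agree κ f hκ j h)
    (fun j hj v => (sum_passageWeight_setBit κ f hκ j hj v).le) A ((4 / 3 : ℝ) ^ P / 2 ^ J) ?_
  · rw [← mul_div_assoc, div_le_iff₀ h2J, one_mul] at key
    exact key
  · intro v hv
    rw [prod_passageWeight_eq κ f v (hforced v hv), div_eq_mul_inv, one_div, inv_pow, mul_comm ((4 / 3 : ℝ) ^ P)]
    rw [mul_assoc, mul_assoc]
    refine mul_le_mul_of_nonneg_left ?_ (by positivity)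
    rw [← mul_assoc]
    exact gain_ge_succ _ _ _ _ (hF v hv) (hP v hv)

end Summit.ValiantsHypothesis.ValiantsHypothesis.Theorems.FifoMatching.NNLinearDegreeCofactorHard.CondProbBits

end
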